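import Summits.QuantumFields.YangMills.Theorems.BalabanUVNodesN15KingModelPotentialDressedOperatorSizeOnly

/-!
# N15 (NE2⁺), King-model rung, part 27: THE FACE DECISION — `N15At` on the dressed King carriers, both slot readings, one citation point

Cell `pub-ymgap-dag-n15-d` (R134 acceleration DAG, node N15 = NE2, strategy s3 KING-MODEL RUNG), part 27 (capstone at the node's K4 face; no new estimate).
The node's by-name statement `YMDAG.UVSplit.N15At C = NE2PlusOperator ∧ NE2PlusSite 4 ∧ NE2PlusUnit` on the lineage's two dressed King carriers:

* ★★ `n15_kingModel_faceDecision`: `N15At (kingCarriersSC d L a m² s c₃₅ p)` HOLDS (part 16: the background sort's (3.35) slot carries size ∧ coherence)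
  ∧ `¬ N15At (kingCarriersV d L a m² s c₃₅ p)` (part 25: the (3.35) slot carries size only) ∧, conjunct by conjunct on the size-only carriers, OPERATOR false
  (part 26) ∧ SITE false (parts 21∕25) ∧ UNIT true (part 10d) — the unit layer's predicate is the only one of the three that reads the coherence slot (3.36).

HONEST SCOPE.  King's A = 0 scalar model on the King-admissible tori `Π ℤ∕(2L^{e+1})`, odd `L ≥ 3`, `a, m² > 0`, `c₃₅ > 0`, `0 ≤ s ≤ L^{−1∕2}`; scalar potentials
(NOT gauge fields); OUR slot readings of [B9] (3.35)∕(3.36); NOT Bałaban's carriers of record (NODE 00), not `G_k(U)` ∕ `H_k(U)` ∕ `C^{(k)}(Λ;U)`; count-neutral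
(`--supports`), NOT a discharge of N15; THEOREMS ONLY (0 `def`, 0 `sorry`), standard axioms.

References: [B9] = Bałaban, Commun. Math. Phys. 102 (1985) 385–462, (3.35)–(3.36) p.396, Thm 3.1 p.397, Thm 3.14 pp.426–427, Thm 3.15 p.432 (quantifier
templates) (bib key `Balaban1985BackgroundPropagators`); C. King, Commun. Math. Phys. 102 (1986) 649–677, Prop. 3.8 (3.71) p.664, Lemma 4.5 (4.38) p.674
(A = 0 model) (bib key `King1986`).
-/

noncomputable section

namespace Summit.QuantumFields.YangMills.BalabanUVNodes.N15.KingModel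

open Literature.MathematicalPhysics.QuantumFieldTheory.Balaban1983to89.T4EtaRate (NE2PlusOperator NE2PlusSite NE2PlusUnit)
open YMDAG.UVSplit (NE2Carriers N15At)

/-- **THE FACE DECISION** (module docstring): `N15At` holds on the size-and-coherence dressed carriers and fails on the size-only ones; on the latter the
operator and site conjuncts are false and the unit conjunct is true. [cite: Balaban1985BackgroundPropagators, (3.35)–(3.36) p.396 + Thm 3.1 p.397 + Thm 3.14 pp.426–427 + Thm 3.15 (3.187) p.432 (quantifier templates); King1986, Prop. 3.8 (3.71) p.664 + Lemma 4.5 (4.38) p.674 (A = 0 model)] -/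
theorem n15_kingModel_faceDecision (d : ℕ) {L : ℕ} [NeZero L] (hLodd : Odd L) (hL : 2 ≤ L) {a m2 : ℝ} (ha : 0 < a) (hm : 0 < m2)
    {c35 : ℝ} (hc : 0 < c35) {s : ℝ} (hs0 : 0 ≤ s) (hs1 : s ≤ (L : ℝ) ^ (-(1 / 2 : ℝ))) (p : ℝ) :
    N15At (kingCarriersSC d L a m2 s c35 p)
    ∧ ¬ N15At (kingCarriersV d L a m2 s c35 p)
    ∧ (¬ NE2PlusOperator (kingCarriersV d L a m2 s c35 p).c35 (kingCarriersV d L a m2 s c35 p).pi (kingCarriersV d L a m2 s c35 p).Kop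
      ∧ ¬ NE2PlusSite 4 (kingCarriersV d L a m2 s c35 p).p (kingCarriersV d L a m2 s c35 p).c35 (kingCarriersV d L a m2 s c35 p).pi
          (kingCarriersV d L a m2 s c35 p).Ksite
      ∧ NE2PlusUnit (kingCarriersV d L a m2 s c35 p).c35 (kingCarriersV d L a m2 s c35 p).pi (kingCarriersV d L a m2 s c35 p).Kunit
          (kingCarriersV d L a m2 s c35 p).inΛ (kingCarriersV d L a m2 s c35 p).unitDist) :=
  ⟨n15At_kingModelSC d hLodd hL ha hm hc hs0 hs1 p, not_n15At_kingModelV d hLodd hL ha hm hc s p,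
    n15At_kingModelV_conjuncts d hLodd hL ha hm hc hs0 hs1 p⟩

/-- **THE FOUR-TORUS INSTANCE** (`d + 1 = 4`). [cite: King1986, Lemma 4.5 (4.38) p.674 (A = 0 model)] -/
theorem n15_kingModel_faceDecision_dim4 {L : ℕ} [NeZero L] (hLodd : Odd L) (hL : 2 ≤ L) {a m2 : ℝ} (ha : 0 < a) (hm : 0 < m2) {c35 : ℝ}
    (hc : 0 < c35) {s : ℝ} (hs0 : 0 ≤ s) (hs1 : s ≤ (L : ℝ) ^ (-(1 / 2 : ℝ))) (p : ℝ) :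
    N15At (kingCarriersSC 3 L a m2 s c35 p) ∧ ¬ N15At (kingCarriersV 3 L a m2 s c35 p) :=
  ⟨(n15_kingModel_faceDecision 3 hLodd hL ha hm hc hs0 hs1 p).1, (n15_kingModel_faceDecision 3 hLodd hL ha hm hc hs0 hs1 p).2.1⟩

end Summit.QuantumFields.YangMills.BalabanUVNodes.N15.KingModel

end
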